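import Mathlib
import Summits.ValiantsHypothesis.ValiantsHypothesis.Theorems.GrenetZeonHessianRankCodimTwoLatinTableBridge
import Summits.ValiantsHypothesis.ValiantsHypothesis.Theorems.GrenetZeonHessianRankCodimTwoLatinAssembly
import Summits.ValiantsHypothesis.ValiantsHypothesis.Theorems.GrenetZeonHessianRankCodimTwoPlaneCriterion
import HarnessLib

/-!
# Theorem P: the Latin block plane is GOOD for every prime block size `p ≥ 13` (instantiation)

Crux `GrenetZeon.HessianRankCodimTwo` (stmt-ValiantsHypothesis-8061), line `good_plane`
(`Cruxes/HessianRankCodimTwo/GoodPlanesLatinReduction.md` §6).  This file only plugs the three parts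
of the formalisation of Theorem P into each other:

* PART A (8061-p3, `…LatinFrobenius*.lean`): the integer forms `latinPhi ℤ p`, `latinPsi ℤ p I J`,
  homogeneous of degrees `3p`, `3p − 2`, with `Φ̃_p(w) = F(w)^p` and
  `Ψ̃_{IJ}(w) = w_{J−I}^{p−2} P_{J−I}(w)^p` over every field of characteristic `p`;
* PART B (8061-p4, `…LatinTable*.lean`): on the Latin block plane of size `3p` the permanent vanishes
  iff `Φ̃_p` does and the block value `h_{IJ}` vanishes iff `Ψ̃_{IJ}` does (table identity / fibre
  count, normalising factorials `(p!)³`, `(p−2)!·p!·p!` non-zero in `ℂ`);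
* PART C (8061-p2, `…LatinAssembly.lean`, `…ReduceModP.lean`, `…LatinPlane.lean`, `…BlockEigen.lean`):
  reduction of a common zero modulo `p`, the elimination `F = w_d P_d = w_{d'} P_{d'} = 0 ⇒ w = 0`,
  and the block-eigenvector rank bound.

Results: `latinBlockNonvanishing_three_mul_prime` — (★) `LatinBlockNonvanishing p 0` for every prime
`p ≥ 3`; `goodPlane_three_mul_prime` — for every prime `p ≥ 13` the Latin block plane is a GOOD PLANE
for `per_{3p}` (`GoodPlane (3p)` of the skeleton, unfolded): at every non-zero point of the plane on
the permanental hypersurface the Hessian of `per_{3p}` has rank `> (3p)²/2`.  With p1's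
`planeCriterion` this gives the crux statement `HessianRankCodimTwo` AT EVERY `n = 3p`, `p ≥ 13`
prime (`hessianRankCodimTwo_at_three_mul_prime`) — an infinite family, not the cofinite statement the
crux asks for (that residual stays open: `stub_goodPlanes` / bordered planes).  VP ≠ VNP is not
moved: the crux feeds only the constant-factor bound `TwoDimCoefficients`.
-/

noncomputable section

open MvPolynomial Finset
open Literature.Computability.AlgebraicComplexity

-- single-conjunct layout `Summits/ValiantsHypothesis/ValiantsHypothesis`: duplicated namespace by design
set_option linter.dupNamespace false

namespace Summit.ValiantsHypothesis.ValiantsHypothesis.Theorems.GrenetZeonHessianRankCodimTwo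

variable {p : ℕ}

/-- **Theorem P (★ for prime block size).** For every prime `p ≥ 3`, at every point of the Latin
block plane of size `n = 3p` (no border) lying on the permanental hypersurface, at least six of the
nine block values are non-zero. [folklore] -/
theorem latinBlockNonvanishing_three_mul_prime (hp : p.Prime) (h3 : 3 ≤ p) :
    LatinBlockNonvanishing p 0 := by
  haveI : Fact p.Prime := ⟨hp⟩
  have hp0 : 0 < p := hp.pos
  exact latinBlockNonvanishing_of_congruences hp h3 (latinPhi ℤ p) (fun I J => latinPsi ℤ p I J)
    (3 * p) (3 * p - 2) (latinPhi_isHomogeneous (R := ℤ) p)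
    (fun I J => latinPsi_isHomogeneous (R := ℤ) p (by omega) I J)
    (fun a h => (eval_perPoly_latinPoint_zero_eq_zero_iff_latinPhi hp0 a).mp h)
    (fun hm a I J h => (latinBlockValue_zero_eq_zero_iff_latinPsi hm a I J).mp h)
    (fun L _ _ w => aeval_latinPhi_int p w)
    (fun L _ _ w I J => aeval_latinPsi_int p w I J)

/-- **Theorem P: `GoodPlane (3p)` for every prime `p ≥ 13`** (the statement `GoodPlane (3 * p + 0)` of
`Cruxes/HessianRankCodimTwo/Lines/good_plane.lean`, unfolded): the three Latin basis matrices are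
linearly independent and at every non-zero point of their span on `Z(per_{3p})` the Hessian of
`per_{3p}` has rank `> (3p)²/2`. [folklore] -/
theorem goodPlane_three_mul_prime (hp : p.Prime) (h13 : 13 ≤ p) :
    ∃ w : Fin 3 → (Fin (3 * p + 0) × Fin (3 * p + 0) → ℂ), LinearIndependent ℂ w ∧
      ∀ a : Fin 3 → ℂ, a ≠ 0 →
        MvPolynomial.eval (∑ i, a i • w i) (perPoly (Fin (3 * p + 0)) ℂ) = 0 →
        (3 * p + 0) ^ 2 <
          2 * (hess0 (transl (∑ i, a i • w i) (perPoly (Fin (3 * p + 0)) ℂ))).rank :=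
  goodPlane_of_latinBlockNonvanishing (by omega) (by norm_num)
    (latinBlockNonvanishing_three_mul_prime hp (by omega))

/-- **The crux statement at every `n = 3p`, `p ≥ 13` prime.**  Every non-empty hypersurface section
`Z(per_n) ∩ Z(g)` contains a point where the Hessian of `per_n` has rank `> n²/2`, for `n = 3p`
(p1's plane criterion applied to the Latin block plane).  This is the body of
`Theses.GrenetZeon.HessianRankCodimTwo` at these `n`; the crux itself asks for all large `n`.
[folklore] -/
theorem hessianRankCodimTwo_at_three_mul_prime (hp : p.Prime) (h13 : 13 ≤ p)
    (g : MvPolynomial (Fin (3 * p + 0) × Fin (3 * p + 0)) ℂ)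
    (hg : ∃ q : Fin (3 * p + 0) × Fin (3 * p + 0) → ℂ,
      MvPolynomial.eval q (perPoly (Fin (3 * p + 0)) ℂ) = 0 ∧ MvPolynomial.eval q g = 0) :
    ∃ q : Fin (3 * p + 0) × Fin (3 * p + 0) → ℂ,
      MvPolynomial.eval q (perPoly (Fin (3 * p + 0)) ℂ) = 0 ∧ MvPolynomial.eval q g = 0 ∧
        (3 * p + 0) ^ 2 < 2 * (hess0 (transl q (perPoly (Fin (3 * p + 0)) ℂ))).rank :=
  Summit.ValiantsHypothesis.ValiantsHypothesis.Theorems.GrenetZeon.HessianRankCodimTwo.planeCriterion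
    (3 * p + 0) (goodPlane_three_mul_prime hp h13) g hg

end Summit.ValiantsHypothesis.ValiantsHypothesis.Theorems.GrenetZeonHessianRankCodimTwo
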